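import Summits.HodgeConjecture.HodgeConjecture.Theorems.R90S3VanDijkParabolicIndGLAdmissible          -- ★ the HEAD (K2E3-p21 g9): `GLn.vanDijkTraceParabolicIndGL_admissible`, `integral_conj_eq_integral_prod`; brings ★ K-INSIDE p862578
import Literature.NumberTheory.Automorphic.SmoothCharacterTwist                                   -- ★ `smoothTrace_twist_eq` (twisted ↔ factor form)
import Literature.NumberTheory.Automorphic.SmoothCharacterOfCharacter                             -- ★ `smoothTrace_trivial_twist_eq_charDist_of_mem`, `isAdmissible_trivial_twist` (the line case)
import HarnessLib

/-!
# R90-TF · S3 · THEOREMS — `R90S3VanDijkParabolicIndGLAdmissibleLineCase` (VD₂ HEAD, companion): the FACTOR form of van Dijk's formula for `Ind_{P_c}^{GL_N}(σ)`,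
# and the LINE CASE re-derived from the vector-valued head (sanity check of the constant and the measures against ★ `GLn.vanDijkTraceParabolicIndGL_holds`)

R90-TF section S3 = [Rogawski1990] Ch. 12 ∕ §4.13 (dealer R90-C12-plan (g0)); crux H413 (`stmt-HodgeConjecture-24833`, lane `--supports … --as helper`), route of
record `HCCMUnconditional`; hand S3-p12 «(VD₂)», HEAD dealt to K2E3-p21 (g9) by RULING S3-R13; this file carries the two corollaries REQUIRED by RULING S3-R10 (2),
split off the HEAD file ★ `Theorems/R90S3VanDijkParabolicIndGLAdmissible` only for the 400-line rule.  THEOREMS ONLY (no `def`, no `instance`, no notation, no named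
fact, no `sorry`); never imports `Cruxes/…/Lines`.

THE MATHEMATICS ([vanDijk1972, Thm. p. 237]; [BernsteinZelevinsky1977, §2.3]; [Rogawski1990, §4.13 Lemma 4.13.1 (b) p. 64]; [BushnellHenniart2006, §9.5 (9.5.1)]).
With the HEAD's notation (`σ_M = (σ ∘ proj|_{M_c}) ⊗ δ_{P_c}^{1∕2}|_{M_c}`, `Ψ(m) = ∫_{K × U_c} f(k (m u) k⁻¹) d(κ¹ ⊗ μ¹_U)`, constant `ν(K)∕ν_M(M_c ∩ K)`):
* `GLn.vanDijkTraceParabolicIndGL_admissible_factor` — `tr π(f dν) = (ν(K)∕ν_M(M_c ∩ K)) · tr (σ ∘ proj|_{M_c})(m ↦ δ^{1∕2}(m) Ψ(m))`: the character of a twist is the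
  character against the twisted test function, `tr (ρ ⊗ δ)(φ) = tr ρ(δ·φ)` (★ `smoothTrace_twist_eq`; `ker δ^{1∕2}|_{M_c}` open ★ `isOpen_ker_rootDeltaChar_standardParabolicGL`;
  `σ ∘ proj|_{M_c}` admissible as `proj|_{M_c}` is a homeomorphic isomorphism ★ `exists_homeomorph_leviProjection_inclusion` + ★ `IsAdmissible.comp_of_isOpenMap`).
  This is the dealer's head (a) of RULING S3-R10 and the spelling of R90-C14-p01's parallel «GL3» head.
* the LINE CASE as a kernel-checked `example` (its statement is literally ★ `GLn.vanDijkTraceParabolicIndGL_holds`, so it is not re-declared — `dedup.landed`): at `W = ℂ`,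
  `σ = 𝟙 ⊗ χ` (`ker χ` open) the head IS ★ `VanDijkTraceParabolicIndGL F c χ ν ν_M`: `(𝟙 ⊗ χ) ∘ proj|_{M_c}
  = 𝟙_{M_c} ⊗ (χ ∘ proj|_{M_c})` definitionally and `tr (𝟙 ⊗ ξ)(φ) = ∫ ξ φ` (★ `smoothTrace_trivial_twist_eq_charDist_of_mem`; `Ψ` is a test function on `M_c` by ★ K-INSIDE
  (3′) and the HEAD's §1 `Φ = Ψ`).  So the vector-valued road re-proves ★ `GLn.vanDijkTraceParabolicIndGL_holds` with the SAME constant `ν(K)∕ν_M(M_c ∩ K)` and the SAME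
  unit-mass `κ¹ ⊗ μ¹_U` — the regression test asked for by AUDIT S3#39 (1).

HONEST LABEL: HC_CM is proved only modulo the 7 printed citations (2 remaining named inputs: hLiu418 = stmt-HodgeConjecture-24832, h413 =
stmt-HodgeConjecture-24833) until rung 0 closes; local harmonic analysis on `GL_N`, proves nothing printed of Ch. 13, pays no socket by itself; count-neutral helper.

## References
* [vanDijk1972] G. van Dijk, *Computation of certain induced characters of 𝔭-adic groups*, Math. Ann. 199 (1972), 229–240, Thm. p. 237.
* [BernsteinZelevinsky1977] I. N. Bernstein, A. V. Zelevinsky, *Induced representations of reductive 𝔭-adic groups I*, Ann. Sci. ÉNS 10 (1977), §1.8, §2.3.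
* [Rogawski1990] J. D. Rogawski, *Automorphic Representations of Unitary Groups in Three Variables*, Ann. of Math. Stud. 123 (1990), §4.13 Lemma 4.13.1 (b) p. 64.
* [BushnellHenniart2006] C. J. Bushnell, G. Henniart, *The Local Langlands Conjecture for GL(2)*, Grundlehren 335 (2006), §9.5 (9.5.1) p. 65; §1.5.
* [GetzHahn2024] J. R. Getz, H. Hahn, *An Introduction to Automorphic Representations*, GTM 300 (2024), §8.5 (8.15) p. 159.
-/

set_option autoImplicit false
-- the mandated namespace repeats the single-problem summit's segment (`HodgeConjecture.HodgeConjecture`)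
set_option linter.dupNamespace false

noncomputable section

open MeasureTheory MeasureTheory.Measure Topology TopologicalSpace
open scoped MatrixGroups NNReal ENNReal

namespace Summit.HodgeConjecture.HodgeConjecture.R90.S3

open Literature.NumberTheory.Automorphic Representation
open Literature.NumberTheory.GaloisRepresentations.IsNonarchimedeanLocalField
open Summit.HodgeConjecture.HodgeConjecture.Cruxes.H413.K2E3ParabolicCharacterLeviUnipotentGL
open Summit.HodgeConjecture.HodgeConjecture.Cruxes.H413.K2E3ParabolicIndCharacterGeneral
open Literature.NumberTheory.Rogawski1990 (charDist charDist_def)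

variable {F : Type} [Field F] [ValuativeRel F] [TopologicalSpace F] [IsNonarchimedeanLocalField F]
  {N : ℕ} {α : Type*} [LinearOrder α] [Fintype α] {c : Fin N → α}

/-! ## The factor form and the line case -/

section Corollaries

/-- `σ ∘ proj|_{M_c}` (untwisted) is admissible for `σ` admissible: `proj|_{M_c} : M_c → Π_a GL_{n_a}(F)` is a homeomorphic isomorphism
(★ `exists_homeomorph_leviProjection_inclusion`, ★ `IsAdmissible.comp_of_isOpenMap`). [cite: BernsteinZelevinsky1977, §1.8, Prop. 2.3] -/
theorem isAdmissible_comp_leviProjection_comp_inclusion {W : Type*} [AddCommGroup W] [Module ℂ W]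
    {σ : Representation ℂ (Π a, GL {i : Fin N // c i = a} F) W} (hσ : σ.IsAdmissible) :
    Representation.IsAdmissible (σ.comp ((leviProjection F c).comp (Subgroup.inclusion (standardLeviGL_le F c)))) := by
  haveI : IsTopologicalRing F := inferInstance
  obtain ⟨e, he⟩ := exists_homeomorph_leviProjection_inclusion F c
  have hΘc : Continuous ((leviProjection F c).comp (Subgroup.inclusion (standardLeviGL_le F c))) := by
    convert e.continuous using 1; funext m; exact (he m).symm
  have hΘo : IsOpenMap ((leviProjection F c).comp (Subgroup.inclusion (standardLeviGL_le F c))) := by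
    convert e.isOpenMap using 1; funext m; exact (he m).symm
  exact IsAdmissible.comp_of_isOpenMap σ _ hΘc hΘo hσ

/-- The kernel of `δ_{P_c}^{1∕2}|_{M_c}` is open (★ `isOpen_ker_rootDeltaChar_standardParabolicGL` pulled back along the continuous inclusion `M_c ↪ P_c`).
[cite: BernsteinZelevinsky1977, 1.7] -/
theorem isOpen_ker_rootDeltaChar_comp_inclusion :
    IsOpen ((((rootDeltaChar (standardParabolicGL F c)).comp (Subgroup.inclusion (standardLeviGL_le F c))).ker :
      Subgroup ↥(standardLeviGL F c)) : Set ↥(standardLeviGL F c)) := by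
  haveI : IsTopologicalRing F := inferInstance
  have hic : Continuous (Subgroup.inclusion (standardLeviGL_le F c)) := continuous_induced_rng.2 continuous_subtype_val
  exact (isOpen_ker_rootDeltaChar_standardParabolicGL F c).preimage hic

/-- **FACTOR FORM** of the head: `tr (parabolicIndGL F c σ)(f dν) = (ν(K) ∕ ν_M(M_c ∩ K)) · tr (σ ∘ proj|_{M_c})(m ↦ δ_{P_c}^{1∕2}(m) · ∫_{K × U_c} f(k (m u) k⁻¹) d(κ¹ ⊗ μ¹_U))`
— the modulus factor INSIDE the test function rather than as a twist of `σ_M` (★ `smoothTrace_twist_eq`: `tr (ρ ⊗ δ)(φ) = tr ρ(δ · φ)`, `ker δ|_{M_c}` open); this is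
the dealer's head (a) of RULING S3-R10 and the literal shape of ★ `VanDijkTraceParabolicIndGL` with «`χ(proj m) ·`» ↦ «`tr (σ ∘ proj|_{M_c})` of».
[cite: Rogawski1990, §4.13 Lemma 4.13.1 (b) p. 64] [cite: BushnellHenniart2006, §9.5 (9.5.1) p. 65] -/
theorem GLn.vanDijkTraceParabolicIndGL_admissible_factor (hc : Monotone c)
    {W : Type*} [AddCommGroup W] [Module ℂ W] (σ : Representation ℂ (Π a, GL {i : Fin N // c i = a} F) W) (hσ : σ.IsAdmissible) :
    letI : MeasurableSpace (GL (Fin N) F) := borel _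
    haveI : BorelSpace (GL (Fin N) F) := ⟨rfl⟩
    ∀ (ν : Measure (GL (Fin N) F)) [ν.IsHaarMeasure] (νM : Measure ↥(standardLeviGL F c)) [νM.IsHaarMeasure]
      (f : GL (Fin N) F → ℂ), IsLocallyConstant f → HasCompactSupport f →
      (Representation.parabolicIndGL F c σ).smoothTrace ν f =
        (((ν (glInt N F : Set (GL (Fin N) F))).toReal / (νM {m | (m : GL (Fin N) F) ∈ glInt N F}).toReal : ℝ) : ℂ) *
          Representation.smoothTrace (σ.comp ((leviProjection F c).comp (Subgroup.inclusion (standardLeviGL_le F c)))) νM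
            (fun m : ↥(standardLeviGL F c) =>
              ((rootDeltaChar (standardParabolicGL F c) ⟨(m : GL (Fin N) F), standardLeviGL_le F c m.2⟩ : ℂˣ) : ℂ) *
              ∫ q : ↥(glInt N F) × ↥(unipotentRadicalGL F c),
                f ((q.1 : GL (Fin N) F) * (((m : GL (Fin N) F)) * (q.2 : GL (Fin N) F)) * (q.1 : GL (Fin N) F)⁻¹)
                ∂((haarMeasure (⟨⟨Set.univ, isCompact_iff_isCompact_univ.1 (isCompact_glInt (n := N) (F := F))⟩, by
                      simp only [interior_univ, Set.univ_nonempty]⟩ : PositiveCompacts ↥(glInt N F))).prod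
                  (haarMeasure (⟨⟨((↑) : ↥(unipotentRadicalGL F c) → GL (Fin N) F) ⁻¹' (glInt N F : Set (GL (Fin N) F)),
                      haveI := (isLocalField F).toT2Space
                      (isClosed_unipotentRadicalGL (R := F) c).isClosedEmbedding_subtypeVal.isCompact_preimage (isCompact_glInt (n := N) (F := F))⟩,
                      ⟨1, ((isOpen_glInt (n := N) (F := F)).preimage continuous_subtype_val).interior_eq.symm ▸ (glInt N F).one_mem⟩⟩ :
                      PositiveCompacts ↥(unipotentRadicalGL F c))))) := by
  letI : MeasurableSpace (GL (Fin N) F) := borel _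
  haveI : BorelSpace (GL (Fin N) F) := ⟨rfl⟩
  intro ν _ νM _ f hflc hfcs
  haveI : T2Space F := (isLocalField F).toT2Space
  haveI : IsTopologicalRing F := inferInstance
  haveI : NonarchimedeanGroup (GL (Fin N) F) := nonarchimedeanGroup_gl F N
  haveI : LocallyCompactSpace (GL (Fin N) F) := by
    haveI : LocallyCompactSpace F := (isLocalField F).toLocallyCompactSpace
    haveI : LocallyCompactSpace (Matrix (Fin N) (Fin N) F) := inferInstanceAs (LocallyCompactSpace (Fin N → Fin N → F))
    infer_instance
  have hMcl : IsClosed (standardLeviGL F c : Set (GL (Fin N) F)) := isClosed_standardLeviGL (R := F) c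
  haveI : LocallyCompactSpace ↥(standardLeviGL F c) := hMcl.locallyCompactSpace
  haveI : NonarchimedeanGroup ↥(standardLeviGL F c) := NonarchimedeanGroup.subgroup _
  rw [GLn.vanDijkTraceParabolicIndGL_admissible (F := F) hc σ hσ ν νM f hflc hfcs,
    smoothTrace_twist_eq ((rootDeltaChar (standardParabolicGL F c)).comp (Subgroup.inclusion (standardLeviGL_le F c)))
      (σ.comp ((leviProjection F c).comp (Subgroup.inclusion (standardLeviGL_le F c)))) νM
      (isAdmissible_comp_leviProjection_comp_inclusion (c := c) hσ) (isOpen_ker_rootDeltaChar_comp_inclusion (c := c))]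
  rfl

/- **THE LINE CASE, RE-DERIVED (an `example`, not a theorem: its statement IS ★ `GLn.vanDijkTraceParabolicIndGL_holds`, which the gate's
`dedup.landed` lint rightly refuses to restate — the point here is the RE-DERIVATION through the vector-valued head, kernel-checked at every build) — sanity check of the constant and of the measures**: at `W = ℂ`, `σ = 𝟙.twist χ` for a character `χ` of the block Levi with open
kernel, the HEAD gives EXACTLY ★ `VanDijkTraceParabolicIndGL F c χ ν ν_M` — `tr (𝟙_{M_c} ⊗ (χ ∘ proj) ⊗ δ^{1∕2})(Ψ) = ∫_{M_c} χ(proj m) δ^{1∕2}(m) Ψ(m) dν_M` by ★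
`smoothTrace_twist_eq` and ★ `smoothTrace_trivial_twist_eq_charDist_of_mem` (the test-function property of `Ψ` from ★ K-INSIDE (3′) and §1).  Hence this file
re-proves ★ `GLn.vanDijkTraceParabolicIndGL_holds` through the vector-valued road (same constant `ν(K)∕ν_M(M_c ∩ K)`, same unit-mass `κ¹ ⊗ μ¹_U`).
[cite: vanDijk1972, Thm. p. 237] [cite: Rogawski1990, §4.13 Lemma 4.13.1 (b) p. 64] -/
example (hc : Monotone c)
    (χ : (Π a, GL {i : Fin N // c i = a} F) →* ℂˣ) (hχ : IsOpen (χ.ker : Set (Π a, GL {i : Fin N // c i = a} F))) :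
    letI : MeasurableSpace (GL (Fin N) F) := borel _
    ∀ (ν : Measure (GL (Fin N) F)) [ν.IsHaarMeasure] (νM : Measure ↥(standardLeviGL F c)) [νM.IsHaarMeasure],
      VanDijkTraceParabolicIndGL F c χ ν νM := by
  letI : MeasurableSpace (GL (Fin N) F) := borel _
  haveI : BorelSpace (GL (Fin N) F) := ⟨rfl⟩
  intro ν _ νM _ f hflc hfcs
  haveI : T2Space F := (isLocalField F).toT2Space
  haveI : IsTopologicalRing F := inferInstance
  haveI : NonarchimedeanGroup (GL (Fin N) F) := nonarchimedeanGroup_gl F N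
  haveI : LocallyCompactSpace (GL (Fin N) F) := by
    haveI : LocallyCompactSpace F := (isLocalField F).toLocallyCompactSpace
    haveI : LocallyCompactSpace (Matrix (Fin N) (Fin N) F) := inferInstanceAs (LocallyCompactSpace (Fin N → Fin N → F))
    infer_instance
  have hKc : IsCompact (glInt N F : Set (GL (Fin N) F)) := isCompact_glInt (n := N) (F := F)
  haveI : CompactSpace ↥(glInt N F) := isCompact_iff_compactSpace.1 hKc
  have hMcl : IsClosed (standardLeviGL F c : Set (GL (Fin N) F)) := isClosed_standardLeviGL (R := F) c
  haveI : LocallyCompactSpace ↥(standardLeviGL F c) := hMcl.locallyCompactSpace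
  haveI : NonarchimedeanGroup ↥(standardLeviGL F c) := NonarchimedeanGroup.subgroup _
  -- the head at `σ = 𝟙.twist χ`, in the factor form
  have hσ : ((Representation.trivial ℂ (Π a, GL {i : Fin N // c i = a} F) ℂ).twist χ).IsAdmissible := isAdmissible_trivial_twist hχ
  rw [GLn.vanDijkTraceParabolicIndGL_admissible_factor (F := F) hc _ hσ ν νM f hflc hfcs]
  congr 1
  -- the unit-mass measures (names only, to call ★ K-INSIDE for the test-function property of `Ψ`)
  set KK : PositiveCompacts ↥(glInt N F) := ⟨⟨Set.univ, isCompact_iff_isCompact_univ.1 (isCompact_glInt (n := N) (F := F))⟩, by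
      simp only [interior_univ, Set.univ_nonempty]⟩ with hKK
  set UU : PositiveCompacts ↥(unipotentRadicalGL F c) := ⟨⟨((↑) : ↥(unipotentRadicalGL F c) → GL (Fin N) F) ⁻¹' (glInt N F : Set (GL (Fin N) F)),
      haveI := (isLocalField F).toT2Space
      (isClosed_unipotentRadicalGL (R := F) c).isClosedEmbedding_subtypeVal.isCompact_preimage (isCompact_glInt (n := N) (F := F))⟩,
      ⟨1, ((isOpen_glInt (n := N) (F := F)).preimage continuous_subtype_val).interior_eq.symm ▸ (glInt N F).one_mem⟩⟩ with hUU
  set μK : Measure ↥(glInt N F) := haarMeasure KK with hμK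
  set μU : Measure ↥(unipotentRadicalGL F c) := haarMeasure UU with hμU
  -- `Ψ` is a test function on `M_c`: ★ K-INSIDE (3′) for `Φ`, and `Φ = Ψ` (§1)
  obtain ⟨μP, hμP, C, hC, -, -, hKI⟩ :=
    GLn.exists_smoothTrace_parabolicIndGL_admissible_eq_mul_smoothTrace_integral (F := F) hc _ hσ ν νM μU μK
  obtain ⟨hΦlc, hΦcs, -⟩ := hKI f hflc hfcs
  have hΦΨ : (fun m : ↥(standardLeviGL F c) => ∫ k : ↥(glInt N F), ∫ u : ↥(unipotentRadicalGL F c),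
      f ((k : GL (Fin N) F)⁻¹ * ((m : GL (Fin N) F) * (u : GL (Fin N) F)) * (k : GL (Fin N) F)) ∂μU ∂μK) =
      fun m : ↥(standardLeviGL F c) => ∫ q : ↥(glInt N F) × ↥(unipotentRadicalGL F c),
        f ((q.1 : GL (Fin N) F) * (((m : GL (Fin N) F)) * (q.2 : GL (Fin N) F)) * (q.1 : GL (Fin N) F)⁻¹) ∂(μK.prod μU) :=
    funext fun m => integral_conj_eq_integral_prod (c := c) hflc hfcs μK μU m
  have hΨ : (fun m : ↥(standardLeviGL F c) => ∫ q : ↥(glInt N F) × ↥(unipotentRadicalGL F c),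
        f ((q.1 : GL (Fin N) F) * (((m : GL (Fin N) F)) * (q.2 : GL (Fin N) F)) * (q.1 : GL (Fin N) F)⁻¹) ∂(μK.prod μU)) ∈
      SchwartzBruhat ↥(standardLeviGL F c) := by
    rw [← hΦΨ]; exact ⟨hΦlc, hΦcs⟩
  -- the modulus factor is locally constant (open kernel), so `δ^{1/2} · Ψ` is again a test function
  have hδlc : IsLocallyConstant fun m : ↥(standardLeviGL F c) =>
      ((((rootDeltaChar (standardParabolicGL F c)).comp (Subgroup.inclusion (standardLeviGL_le F c))) m : ℂˣ) : ℂ) :=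
    isLocallyConstant_unitsCoe_of_isOpen_ker' _ (isOpen_ker_rootDeltaChar_comp_inclusion (c := c))
  have hδΨ : (fun m : ↥(standardLeviGL F c) =>
      ((rootDeltaChar (standardParabolicGL F c) ⟨(m : GL (Fin N) F), standardLeviGL_le F c m.2⟩ : ℂˣ) : ℂ) *
        ∫ q : ↥(glInt N F) × ↥(unipotentRadicalGL F c),
          f ((q.1 : GL (Fin N) F) * (((m : GL (Fin N) F)) * (q.2 : GL (Fin N) F)) * (q.1 : GL (Fin N) F)⁻¹) ∂(μK.prod μU)) ∈
      SchwartzBruhat ↥(standardLeviGL F c) :=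
    ⟨hδlc.mul hΨ.1, hΨ.2.mul_left⟩
  -- `(𝟙 ⊗ χ) ∘ proj|_{M_c} = 𝟙_{M_c} ⊗ (χ ∘ proj|_{M_c})` definitionally; then the character of a one-dimensional representation
  have hker : IsOpen (((χ.comp ((leviProjection F c).comp (Subgroup.inclusion (standardLeviGL_le F c)))).ker :
      Subgroup ↥(standardLeviGL F c)) : Set ↥(standardLeviGL F c)) := by
    have hθc : Continuous ((leviProjection F c).comp (Subgroup.inclusion (standardLeviGL_le F c))) :=
      (continuous_leviProjection F c).comp (continuous_induced_rng.2 continuous_subtype_val)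
    exact hχ.preimage hθc
  change ((Representation.trivial ℂ ↥(standardLeviGL F c) ℂ).twist
      (χ.comp ((leviProjection F c).comp (Subgroup.inclusion (standardLeviGL_le F c))))).smoothTrace νM _ = _
  rw [smoothTrace_trivial_twist_eq_charDist_of_mem νM hker hδΨ, charDist_def]
  rfl

end Corollaries

end Summit.HodgeConjecture.HodgeConjecture.R90.S3

end
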